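import Mathlib.Geometry.Manifold.IsManifold.InteriorBoundary
import Mathlib.Geometry.Manifold.ContMDiff.Atlas
import Mathlib.Geometry.Manifold.ContMDiff.NormedSpace
import HarnessLib

/-!
# The interior of a manifold with boundary as a boundaryless manifold

Topic `Literature/Topology/FourManifolds` (fact seat `provefact-Literature.exists_isBoundaryGluing`,
step A of the DAG recorded there: the gluing `M ∪_φ N` of two manifolds with boundary is
assembled, following Milnor, *Lectures on the h-cobordism theorem* (1965), proof of Thm. 1.4,
from the open pieces `M - ∂M`, `N - ∂N` and a product neighbourhood `∂M × ℝ` of the seam; this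
file provides the first two pieces as manifolds in their own right).

For a `C^∞` manifold `M` with boundary (or corners), modelled on `I : ModelWithCorners ℝ E H`,
the set `I.interior M` of interior points is open (Mathlib, `ModelWithCorners.isOpen_interior`,
smooth invariance of the boundary) and is canonically a manifold *without* boundary modelled on
the model vector space `E` itself (Bröcker–Jänich, *Introduction to Differential Topology*
(1982), (13.3): "`M - ∂M` is canonically an (ordinary) `n`-dimensional manifold, and is called
the interior of `M`").  Mathlib has the interior only as a *set* (`ModelWithCorners.interior`),
and its charted-space structure on open subsets (`TopologicalSpace.Opens`) keeps the model `I`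
with boundary; the re-modelling on `𝓘(ℝ, E)` below is what makes the interior usable as a
*boundaryless* piece of an open gluing (`Literature.Topology.FourManifolds.SmoothGlueData` of `GluingConstruction.lean`,
whose pieces must have boundaryless models).

## Main definitions and results

* `Literature.InteriorManifold I M`: the interior points of `M`, as a structure `⟨val, property⟩`
  (a new type, so that its atlas over `E` cannot be confused with structures on subtypes of
  `M`), with the topology induced by `val`.
* `InteriorManifold.interiorChart x`: the chart `y ↦ I (chartAt H x y)` of the interior on
  `val ⁻¹' (chartAt H x).source`, valued in the open subset
  `I.symm ⁻¹' (chartAt H x).target ∩ interior (range I)` of `E`.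
* instances `ChartedSpace E (InteriorManifold I M)`, `IsManifold 𝓘(ℝ, E) ∞ (InteriorManifold I M)`
  (changes of charts are the extended coordinate changes of `M`, smooth on open subsets of the
  interior of `range I`), `T2Space`, `SecondCountableTopology`.
* `InteriorManifold.isOpenEmbedding_val`, `range_val`, `contMDiff_val`: the inclusion into `M`
  is an open smooth embedding onto `I.interior M`.
* `InteriorManifold.contMDiffWithinAt_iff_comp_val` (and `On`/`At`/global versions): a map
  *into* the interior is `C^n` iff it is `C^n` as a map into `M`.
* `InteriorManifold.extChartAt_coe`: the extended charts of the interior are the extended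
  charts of `M` composed with the inclusion (the bookkeeping identity used downstream).

Everything is proved; no named facts.

## Relation to `Literature.Topology.FourManifolds.ManifoldInterior`

The tree already has the *topological* interior
`Literature.ManifoldInterior n W := ↥((𝓡∂ (n + 1)).interior W)`
(`BoundarySignature.lean`, with `T2Space`/`LocallyCompactSpace` instances and, in
`ClosedModelCharts.lean`, topological charts used for the one-point compactification
`ClosedModel`). The present `Literature.InteriorManifold I M` is the *smooth* version, for an arbitrary
real model with corners `I` (not only `𝓡∂ (n + 1)`), packaged as a new structure so that its
boundaryless atlas over `E` and the instances `ChartedSpace E`, `IsManifold 𝓘(ℝ, E) ∞` cannot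
interfere with instances carried by subtypes of `M`; `InteriorManifold.equivSubtype` identifies
it with `↥(I.interior M)` (hence with `ManifoldInterior n W` when `I = 𝓡∂ (n + 1)`). Importing
`BoundarySignature.lean` here would pull singular homology into the differential-topology files
downstream, so the two are kept apart.

## References

* T. Bröcker, K. Jänich, *Introduction to Differential Topology*, CUP (1982), (13.3).
  [BrockerJanich1982]
* J. Milnor, *Lectures on the h-cobordism theorem*, Princeton (1965), proof of Thm. 1.4.
  [MilnorHCobordism1965]
-/

open scoped Manifold ContDiff Topology
open Set Function Topology

noncomputable section

namespace Literature.Topology.FourManifolds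

universe u

variable {E H : Type*} [NormedAddCommGroup E] [NormedSpace ℝ E] [TopologicalSpace H]
  (I : ModelWithCorners ℝ E H) (M : Type u) [TopologicalSpace M] [ChartedSpace H M]

/-- **The interior of a manifold with boundary**, `M - ∂M`, as a type: the interior points of
`M` for the model with corners `I` (Bröcker–Jänich (1982), (13.3)). It carries the topology
induced from `M` and (below) the structure of a `C^∞` manifold modelled on the vector space `E`.
[cite: BrockerJanich1982, (13.3)] -/
@[ext]
structure InteriorManifold : Type u where
  /-- The underlying point of `M`. -/
  val : M
  /-- The underlying point is an interior point. -/
  property : I.IsInteriorPoint val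

namespace InteriorManifold

variable {I M}

/-- The topology of the interior is induced from `M`. [folklore] -/
instance instTopologicalSpace : TopologicalSpace (InteriorManifold I M) :=
  TopologicalSpace.induced val inferInstance

/-- Points of the interior are interior points of `M`. [folklore] -/
theorem isInteriorPoint (x : InteriorManifold I M) : I.IsInteriorPoint x.val := x.property

/-- Points of the interior lie in `I.interior M`. [folklore] -/
theorem val_mem_interior (x : InteriorManifold I M) : x.val ∈ I.interior M := x.property

/-- Points of the interior are not boundary points of `M`. [folklore] -/
theorem not_isBoundaryPoint (x : InteriorManifold I M) : ¬ I.IsBoundaryPoint x.val :=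
  (I.isInteriorPoint_iff_not_isBoundaryPoint x.val).1 x.property

/-- Points of the interior do not lie in `I.boundary M`. [folklore] -/
theorem val_notMem_boundary (x : InteriorManifold I M) : x.val ∉ I.boundary M :=
  x.not_isBoundaryPoint

/-- The inclusion of the interior is injective. [folklore] -/
theorem val_injective : Injective (val : InteriorManifold I M → M) :=
  fun _ _ h => InteriorManifold.ext h

/-- Two points of the interior are equal iff their underlying points are. [folklore] -/
theorem val_inj {x y : InteriorManifold I M} : x.val = y.val ↔ x = y := val_injective.eq_iff

/-- The range of the inclusion of the interior is `I.interior M`. [folklore] -/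
@[simp] theorem range_val : range (val : InteriorManifold I M → M) = I.interior M := by
  ext m
  exact ⟨fun ⟨x, hx⟩ => hx ▸ x.property, fun hm => ⟨⟨m, hm⟩, rfl⟩⟩

/-- The interior, as a type, is equivalent to the subtype `I.interior M` of `M`. [folklore] -/
@[simps]
def equivSubtype : InteriorManifold I M ≃ I.interior M where
  toFun x := ⟨x.val, x.property⟩
  invFun m := ⟨m.1, m.2⟩
  left_inv _ := rfl
  right_inv _ := rfl

/-- The inclusion of the interior induces its topology (definitional). [folklore] -/
theorem isInducing_val : IsInducing (val : InteriorManifold I M → M) := ⟨rfl⟩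

/-- The inclusion of the interior is a topological embedding. [folklore] -/
theorem isEmbedding_val : IsEmbedding (val : InteriorManifold I M → M) :=
  ⟨isInducing_val, val_injective⟩

/-- The inclusion of the interior is continuous. [folklore] -/
@[continuity, fun_prop]
theorem continuous_val : Continuous (val : InteriorManifold I M → M) :=
  isInducing_val.continuous

/-- A map into the interior is continuous iff it is continuous as a map into `M`. [folklore] -/
theorem continuous_iff_comp_val {X : Type*} [TopologicalSpace X] {g : X → InteriorManifold I M} :
    Continuous g ↔ Continuous (val ∘ g) :=
  isInducing_val.continuous_iff

/-- A map into the interior is continuous on a set iff it is so as a map into `M`. [folklore] -/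
theorem continuousOn_iff_comp_val {X : Type*} [TopologicalSpace X] {g : X → InteriorManifold I M}
    {s : Set X} : ContinuousOn g s ↔ ContinuousOn (val ∘ g) s :=
  isInducing_val.continuousOn_iff

/-- The interior of a Hausdorff manifold is Hausdorff. [folklore] -/
instance instT2Space [T2Space M] : T2Space (InteriorManifold I M) := isEmbedding_val.t2Space

/-- The interior of a second-countable manifold is second countable. [folklore] -/
instance instSecondCountableTopology [SecondCountableTopology M] :
    SecondCountableTopology (InteriorManifold I M) :=
  isInducing_val.secondCountableTopology

variable [IsManifold I ∞ M]

/-- `I.interior M` is open in `M` (Mathlib's `ModelWithCorners.isOpen_interior` for `C^∞`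
manifolds). [folklore] -/
theorem isOpen_interior_carrier : IsOpen (I.interior M) :=
  ModelWithCorners.isOpen_interior (I := I) (M := M) (n := ∞) (by simp)

/-- The interior of a `C^∞` manifold is open, so the inclusion of the interior is an open
embedding. [folklore] -/
theorem isOpenEmbedding_val : IsOpenEmbedding (val : InteriorManifold I M → M) :=
  ⟨isEmbedding_val, range_val (I := I) (M := M) ▸ isOpen_interior_carrier⟩

/-- The inclusion of the interior is an open map. [folklore] -/
theorem isOpenMap_val : IsOpenMap (val : InteriorManifold I M → M) :=
  isOpenEmbedding_val.isOpenMap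

/-! ### Charts -/

omit [IsManifold I ∞ M] in
/-- A chart of the atlas of a `C¹` manifold sends the interior points of its source into the
interior of the range of the model (smooth invariance of the boundary, Mathlib's
`ModelWithCorners.isInteriorPoint_iff_of_mem_atlas`). [folklore] -/
theorem extend_mem_interior_range [IsManifold I 1 M] {e : OpenPartialHomeomorph M H}
    (he : e ∈ atlas H M) {x : M} (hx : x ∈ e.source) (h : I.IsInteriorPoint x) :
    e.extend I x ∈ interior (range I) :=
  e.interior_extend_target_subset_interior_range
    ((I.isInteriorPoint_iff_of_mem_atlas (n := 1) one_ne_zero he hx).1 h)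

omit [IsManifold I ∞ M] in
/-- Conversely, a point of the source of an atlas chart sent into the interior of the range of
the model is an interior point. [folklore] -/
theorem isInteriorPoint_of_extend_mem_interior_range [IsManifold I 1 M]
    {e : OpenPartialHomeomorph M H} (he : e ∈ atlas H M) {x : M} (hx : x ∈ e.source)
    (h : e.extend I x ∈ interior (range I)) : I.IsInteriorPoint x := by
  refine (I.isInteriorPoint_iff_of_mem_atlas (n := 1) one_ne_zero he hx).2 ?_
  have h' : I (e x) ∈ interior (range I) := by simpa [e.extend_coe] using h
  simpa [e.extend_coe] using e.mem_interior_extend_target (e.map_source hx) h'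

omit [IsManifold I ∞ M] in
/-- For `u` in `I.symm ⁻¹' e.target ∩ interior (range I)`, the point `e.symm (I.symm u)` is an
interior point of `M`. [folklore] -/
theorem isInteriorPoint_extend_symm [IsManifold I 1 M] {e : OpenPartialHomeomorph M H}
    (he : e ∈ atlas H M) {u : E} (hu : u ∈ I.symm ⁻¹' e.target ∩ interior (range I)) :
    I.IsInteriorPoint ((e.extend I).symm u) := by
  have hu' : (e.extend I).symm u ∈ e.source := by
    rw [e.extend_coe_symm]
    exact e.map_target hu.1
  have hu'' : u ∈ (e.extend I).target := by
    rw [e.extend_target]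
    exact ⟨hu.1, interior_subset hu.2⟩
  refine isInteriorPoint_of_extend_mem_interior_range he hu' ?_
  rw [(e.extend I).right_inv hu'']
  exact hu.2

open Classical in
/-- The inverse of the chart of the interior at `x`: `u ↦ (chartAt H x).symm (I.symm u)` on
`I.symm ⁻¹' (chartAt H x).target ∩ interior (range I)`, extended by the junk value `x`.
[folklore] -/
def interiorChartInv (x : InteriorManifold I M) (u : E) : InteriorManifold I M :=
  if h : u ∈ I.symm ⁻¹' (chartAt H x.val).target ∩ interior (range I) then
    ⟨((chartAt H x.val).extend I).symm u, isInteriorPoint_extend_symm (chart_mem_atlas H x.val) h⟩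
  else x

/-- On its domain the inverse chart of the interior is the inverse extended chart of `M`.
[folklore] -/
theorem interiorChartInv_val_of_mem (x : InteriorManifold I M) {u : E}
    (hu : u ∈ I.symm ⁻¹' (chartAt H x.val).target ∩ interior (range I)) :
    (interiorChartInv x u).val = ((chartAt H x.val).extend I).symm u := by
  rw [interiorChartInv, dif_pos hu]

omit [IsManifold I ∞ M] in
/-- A point of the interior in the source of `chartAt H x` is sent by the extended chart into
the domain of the inverse chart. [folklore] -/
theorem extend_chartAt_mem [IsManifold I 1 M] (x : InteriorManifold I M) {y : InteriorManifold I M}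
    (hy : y.val ∈ (chartAt H x.val).source) :
    (chartAt H x.val).extend I y.val ∈
      I.symm ⁻¹' (chartAt H x.val).target ∩ interior (range I) := by
  refine ⟨?_, extend_mem_interior_range (chart_mem_atlas H x.val) hy y.property⟩
  simp only [OpenPartialHomeomorph.extend_coe, comp_apply, mem_preimage, I.left_inv]
  exact (chartAt H x.val).map_source hy

omit [IsManifold I ∞ M] in
/-- The domain of the inverse chart lies in the target of the extended chart of `M`.
[folklore] -/
theorem subset_extend_target (x : InteriorManifold I M) :
    I.symm ⁻¹' (chartAt H x.val).target ∩ interior (range I) ⊆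
      ((chartAt H x.val).extend I).target := by
  rintro u ⟨hu₁, hu₂⟩
  rw [OpenPartialHomeomorph.extend_target]
  exact ⟨hu₁, interior_subset hu₂⟩

/-- **The charts of the interior.** For `x` in the interior, the chart `y ↦ I (chartAt H x y)`
on `val ⁻¹' (chartAt H x).source`, valued in `E`; its target is the open set
`I.symm ⁻¹' (chartAt H x).target ∩ interior (range I)` and its inverse is
`u ↦ (chartAt H x).symm (I.symm u)` there (extended by the junk value `x` elsewhere).
Bröcker–Jänich (1982), (13.3). [folklore] -/
def interiorChart (x : InteriorManifold I M) :
    OpenPartialHomeomorph (InteriorManifold I M) E where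
  toFun y := (chartAt H x.val).extend I y.val
  invFun := interiorChartInv x
  source := val ⁻¹' (chartAt H x.val).source
  target := I.symm ⁻¹' (chartAt H x.val).target ∩ interior (range I)
  map_source' _ hy := extend_chartAt_mem x hy
  map_target' u hu := by
    change (interiorChartInv x u).val ∈ (chartAt H x.val).source
    rw [interiorChartInv_val_of_mem x hu, OpenPartialHomeomorph.extend_coe_symm, comp_apply]
    exact (chartAt H x.val).map_target hu.1
  left_inv' y hy := by
    apply InteriorManifold.ext
    rw [interiorChartInv_val_of_mem x (extend_chartAt_mem x hy)]
    exact (chartAt H x.val).extend_left_inv (I := I) hy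
  right_inv' u hu := by
    rw [interiorChartInv_val_of_mem x hu]
    exact ((chartAt H x.val).extend I).right_inv (subset_extend_target x hu)
  open_source := (chartAt H x.val).open_source.preimage continuous_val
  open_target :=
    ((chartAt H x.val).open_target.preimage I.continuous_symm).inter isOpen_interior
  continuousOn_toFun := by
    refine ((chartAt H x.val).continuousOn_extend (I := I)).comp
      continuous_val.continuousOn fun y hy => ?_
    rwa [OpenPartialHomeomorph.extend_source]
  continuousOn_invFun := by
    rw [continuousOn_iff_comp_val]
    refine (((chartAt H x.val).continuousOn_extend_symm (I := I)).mono
      (subset_extend_target x)).congr ?_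
    intro u hu
    exact interiorChartInv_val_of_mem x hu

/-- The chart of the interior at `x` is `y ↦ I (chartAt H x y)`. [folklore] -/
@[simp] theorem interiorChart_apply (x y : InteriorManifold I M) :
    interiorChart x y = (chartAt H x.val).extend I y.val := rfl

/-- The source of the chart of the interior at `x`. [folklore] -/
@[simp] theorem interiorChart_source (x : InteriorManifold I M) :
    (interiorChart x).source = val ⁻¹' (chartAt H x.val).source := rfl

/-- The target of the chart of the interior at `x`. [folklore] -/
@[simp] theorem interiorChart_target (x : InteriorManifold I M) :
    (interiorChart x).target = I.symm ⁻¹' (chartAt H x.val).target ∩ interior (range I) := rfl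

/-- On its target, the inverse of the chart of the interior at `x` is the inverse extended chart
of `M`. [folklore] -/
theorem interiorChart_symm_apply_val (x : InteriorManifold I M) {u : E}
    (hu : u ∈ (interiorChart x).target) :
    ((interiorChart x).symm u).val = ((chartAt H x.val).extend I).symm u :=
  interiorChartInv_val_of_mem x hu

/-- The target of the chart of the interior at `x` is contained in the target of the extended
chart of `M`. [folklore] -/
theorem interiorChart_target_subset (x : InteriorManifold I M) :
    (interiorChart x).target ⊆ ((chartAt H x.val).extend I).target :=
  subset_extend_target x

/-- **The atlas of the interior**: the charts `interiorChart x`. Bröcker–Jänich (1982), (13.3).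
[folklore] -/
instance instChartedSpace : ChartedSpace E (InteriorManifold I M) where
  atlas := range interiorChart
  chartAt := interiorChart
  mem_chart_source x := mem_chart_source H x.val
  chart_mem_atlas x := mem_range_self x

/-- The preferred chart of the interior at `x` is `interiorChart x` (definitional). [folklore] -/
theorem chartAt_eq (x : InteriorManifold I M) : chartAt E x = interiorChart x := rfl

/-- The atlas of the interior is the range of `interiorChart` (definitional). [folklore] -/
theorem mem_atlas_iff {c : OpenPartialHomeomorph (InteriorManifold I M) E} :
    c ∈ atlas E (InteriorManifold I M) ↔ ∃ x, interiorChart x = c := Iff.rfl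

/-- The change of charts between two charts of the interior is, on its source, the extended
change of coordinates of `M`. [folklore] -/
theorem interiorChart_symm_trans_apply (x x' : InteriorManifold I M) {u : E}
    (hu : u ∈ ((interiorChart x).symm ≫ₕ interiorChart x').source) :
    ((interiorChart x).symm ≫ₕ interiorChart x') u =
      I.extendCoordChange (chartAt H x.val) (chartAt H x'.val) u := by
  simp only [OpenPartialHomeomorph.trans_apply, interiorChart_apply,
    ModelWithCorners.extendCoordChange, PartialEquiv.trans_apply]
  rw [interiorChart_symm_apply_val x hu.1]

/-- The source of the change of charts between two charts of the interior lies in the source of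
the extended change of coordinates of `M`. [folklore] -/
theorem interiorChart_symm_trans_source_subset (x x' : InteriorManifold I M) :
    ((interiorChart x).symm ≫ₕ interiorChart x').source ⊆
      (I.extendCoordChange (chartAt H x.val) (chartAt H x'.val)).source := by
  intro u hu
  have hu₁ : u ∈ (interiorChart x).target := hu.1
  have hu₂ : ((interiorChart x).symm u).val ∈ (chartAt H x'.val).source := hu.2
  rw [interiorChart_symm_apply_val x hu₁] at hu₂
  simp only [ModelWithCorners.extendCoordChange, PartialEquiv.trans_source,
    PartialEquiv.symm_source, mem_inter_iff, mem_preimage, OpenPartialHomeomorph.extend_source]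
  exact ⟨interiorChart_target_subset x hu₁, hu₂⟩

/-- **The interior is a `C^∞` manifold modelled on `E`** (no boundary): the changes of charts
are restrictions of the extended coordinate changes of `M` to open subsets of the interior of
`range I`, where they are `C^∞`. Bröcker–Jänich (1982), (13.3). [folklore] -/
instance instIsManifold : IsManifold 𝓘(ℝ, E) ∞ (InteriorManifold I M) := by
  apply isManifold_of_contDiffOn
  rintro c c' ⟨x, rfl⟩ ⟨x', rfl⟩
  simp only [modelWithCornersSelf_coe, modelWithCornersSelf_coe_symm, CompTriple.comp_eq,
    range_id, inter_univ, preimage_id_eq, id_eq]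
  have h := I.contDiffOn_extendCoordChange (n := ∞)
    (IsManifold.chart_mem_maximalAtlas (I := I) x.val)
    (IsManifold.chart_mem_maximalAtlas (I := I) x'.val)
  refine (h.mono (interiorChart_symm_trans_source_subset x x')).congr ?_
  intro u hu
  exact interiorChart_symm_trans_apply x x' hu

/-! ### Extended charts and smoothness of the inclusion -/

/-- The extended chart of the interior at `x` is the extended chart of `M` at `x` composed with
the inclusion. [folklore] -/
theorem extChartAt_coe (x : InteriorManifold I M) :
    ⇑(extChartAt 𝓘(ℝ, E) x) = fun y => extChartAt I x.val y.val := by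
  ext y
  simp only [extChartAt, OpenPartialHomeomorph.extend_coe, modelWithCornersSelf_coe,
    CompTriple.comp_eq, chartAt_eq, interiorChart_apply]

/-- Pointwise form of `extChartAt_coe`. [folklore] -/
@[simp] theorem extChartAt_apply (x y : InteriorManifold I M) :
    extChartAt 𝓘(ℝ, E) x y = extChartAt I x.val y.val := by
  rw [extChartAt_coe]

/-- The target of the extended chart of the interior at `x`. [folklore] -/
theorem extChartAt_target (x : InteriorManifold I M) :
    (extChartAt 𝓘(ℝ, E) x).target =
      I.symm ⁻¹' (chartAt H x.val).target ∩ interior (range I) := by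
  simp only [extChartAt, OpenPartialHomeomorph.extend_target, modelWithCornersSelf_coe_symm,
    preimage_id_eq, id_eq, range_id, inter_univ, chartAt_eq, interiorChart_target,
    modelWithCornersSelf_coe]

/-- The source of the extended chart of the interior at `x`. [folklore] -/
theorem extChartAt_source (x : InteriorManifold I M) :
    (extChartAt 𝓘(ℝ, E) x).source = val ⁻¹' (chartAt H x.val).source := by
  rw [_root_.extChartAt_source, chartAt_eq, interiorChart_source]

/-- On its target, the inverse extended chart of the interior at `x` is the inverse extended
chart of `M`. [folklore] -/
theorem extChartAt_symm_apply_val (x : InteriorManifold I M) {u : E}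
    (hu : u ∈ (extChartAt 𝓘(ℝ, E) x).target) :
    ((extChartAt 𝓘(ℝ, E) x).symm u).val = (extChartAt I x.val).symm u := by
  rw [extChartAt_target] at hu
  simp only [extChartAt, OpenPartialHomeomorph.extend_coe_symm, modelWithCornersSelf_coe_symm,
    CompTriple.comp_eq, chartAt_eq]
  exact interiorChart_symm_apply_val x hu

/-- **The inclusion of the interior is `C^∞`.** In the charts `interiorChart x`, `chartAt H y` it
reads as a change of coordinates of `M`. [folklore] -/
theorem contMDiff_val : ContMDiff 𝓘(ℝ, E) I ∞ (val : InteriorManifold I M → M) := by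
  rw [contMDiff_iff]
  refine ⟨continuous_val, fun x y => ?_⟩
  have h := I.contDiffOn_extendCoordChange (n := ∞)
    (IsManifold.chart_mem_maximalAtlas (I := I) x.val)
    (IsManifold.chart_mem_maximalAtlas (I := I) y)
  refine (h.mono ?_).congr ?_
  · rintro u ⟨hu₁, hu₂⟩
    have hu₃ := extChartAt_symm_apply_val x hu₁
    simp only [mem_preimage, _root_.extChartAt_source] at hu₂
    rw [hu₃] at hu₂
    rw [extChartAt_target] at hu₁
    simp only [ModelWithCorners.extendCoordChange, PartialEquiv.trans_source,
      PartialEquiv.symm_source, mem_inter_iff, mem_preimage, OpenPartialHomeomorph.extend_source]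
    exact ⟨interiorChart_target_subset x hu₁, hu₂⟩
  · rintro u ⟨hu₁, -⟩
    simp only [comp_apply, ModelWithCorners.extendCoordChange, PartialEquiv.trans_apply]
    rw [extChartAt_symm_apply_val x hu₁]
    rfl

/-- The inclusion of the interior is `C^∞` at every point. [folklore] -/
theorem contMDiffAt_val (x : InteriorManifold I M) :
    ContMDiffAt 𝓘(ℝ, E) I ∞ (val : InteriorManifold I M → M) x :=
  contMDiff_val x

/-! ### Maps into the interior -/

section Into

variable {E' H' : Type*} [NormedAddCommGroup E'] [NormedSpace ℝ E'] [TopologicalSpace H']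
  {J : ModelWithCorners ℝ E' H'} {N : Type*} [TopologicalSpace N] [ChartedSpace H' N]
  {n : ℕ∞}

omit [IsManifold I ∞ M] in
/-- `↑n ≤ ∞` for `n : ℕ∞` (cast bookkeeping). [folklore] -/
private theorem coe_le_infty : (n : ℕ∞ω) ≤ ∞ := by exact_mod_cast le_top

/-- **A map into the interior is `C^n` iff it is `C^n` as a map into `M`** (within a set, at a
point): the extended charts of the interior are those of `M` composed with the inclusion.
[folklore] -/
theorem contMDiffWithinAt_iff_comp_val {g : N → InteriorManifold I M} {s : Set N} {x : N} :
    ContMDiffWithinAt J 𝓘(ℝ, E) n g s x ↔ ContMDiffWithinAt J I n (val ∘ g) s x := by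
  constructor
  · intro h
    exact ((contMDiffAt_val (g x)).of_le coe_le_infty).comp_contMDiffWithinAt x h
  · intro h
    rw [contMDiffWithinAt_iff] at h ⊢
    refine ⟨(isInducing_val.continuousWithinAt_iff (f := g)).2 h.1, ?_⟩
    have : extChartAt 𝓘(ℝ, E) (g x) ∘ g ∘ (extChartAt J x).symm =
        extChartAt I ((val ∘ g) x) ∘ (val ∘ g) ∘ (extChartAt J x).symm := by
      ext u
      simp only [comp_apply, extChartAt_apply]
    rw [this]
    exact h.2

/-- A map into the interior is `C^n` on a set iff it is `C^n` as a map into `M`. [folklore] -/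
theorem contMDiffOn_iff_comp_val {g : N → InteriorManifold I M} {s : Set N} :
    ContMDiffOn J 𝓘(ℝ, E) n g s ↔ ContMDiffOn J I n (val ∘ g) s :=
  ⟨fun h x hx => contMDiffWithinAt_iff_comp_val.1 (h x hx),
    fun h x hx => contMDiffWithinAt_iff_comp_val.2 (h x hx)⟩

/-- A map into the interior is `C^n` at a point iff it is `C^n` as a map into `M`. [folklore] -/
theorem contMDiffAt_iff_comp_val {g : N → InteriorManifold I M} {x : N} :
    ContMDiffAt J 𝓘(ℝ, E) n g x ↔ ContMDiffAt J I n (val ∘ g) x :=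
  contMDiffWithinAt_iff_comp_val

/-- A map into the interior is `C^n` iff it is `C^n` as a map into `M`. [folklore] -/
theorem contMDiff_iff_comp_val {g : N → InteriorManifold I M} :
    ContMDiff J 𝓘(ℝ, E) n g ↔ ContMDiff J I n (val ∘ g) :=
  ⟨fun h x => contMDiffAt_iff_comp_val.1 (h x), fun h x => contMDiffAt_iff_comp_val.2 (h x)⟩

/-- A `C^n` map out of `M` restricts to a `C^n` map out of the interior. [folklore] -/
theorem contMDiffOn_comp_val {f : M → N} {s : Set M} (hf : ContMDiffOn I J n f s) :
    ContMDiffOn 𝓘(ℝ, E) J n (f ∘ (val : InteriorManifold I M → M)) (val ⁻¹' s) :=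
  hf.comp ((contMDiff_val (I := I) (M := M)).of_le coe_le_infty).contMDiffOn fun _ hy => hy

/-- A `C^n` map out of `M` restricts to a `C^n` map out of the interior (global version).
[folklore] -/
theorem contMDiff_comp_val {f : M → N} (hf : ContMDiff I J n f) :
    ContMDiff 𝓘(ℝ, E) J n (f ∘ (val : InteriorManifold I M → M)) :=
  hf.comp ((contMDiff_val (I := I) (M := M)).of_le coe_le_infty)

end Into

end InteriorManifold

end Literature.Topology.FourManifolds
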